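import Summits.FinalStateConjecture.FinalStateConjecture.Theorems.BartnikGapSettlingBondiBartnikRigidityMarchingLemmaSlabFutureGeometry
import Literature.Geometry.Lorentzian.KerrWaveEnergy
import HarnessLib

/-!
# K2b-5 `stub_marchingLemma`, brick 13: the collar set `F` of the marching, basic properties — line
# `direct-method-on-the-cone` (crux `BondiBartnikRigidity`, stmt-FinalStateConjecture-10807)

Kerr-side set geometry (star chart `Kerr.spacetime M a M`, `0 < M`, `|a| < M`, `W = J⁺_K(slab)°`,
translations `T_c y = y + c ∂_{t*}`).  The COLLAR SET of the marching is handed over by its membership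
predicate
`x ∈ F ↔ x ∈ W ∧ t*(x) + (2/3) r(x) < w₀ ∧ ∃ s ∈ (0, η), T_{−s} x ∉ J⁺_K(slab)`
("within vertical distance `η` above the floor `∂J⁺_K(slab) = slab ∪ roof`").  Content:

* `isFutureTimelikeCurveOn_vertical` — `u ↦ T_u y` is a future timelike curve where `r > 2M`
  (`g(∂_{t*}, ∂_{t*}) = −1 + 2H`, `H ≤ M/r`); `translate_mem_interior_of_mem_frontier` — `T_c z ∈ W` for
  a frontier point `z` and `c > 0`; `radius_ge_of_mem_roofK` — `roofK ⊆ {r ≥ 3M}`;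
* `isOpen_collarSet`, `collarSet_vertical` (vertically closed inside `W`), `low_subset_collarSet`
  (`W ∩ {t* < η} ∩ {w < w₀} ⊆ F`), `collarSet_floor` (below every point of `F` a vertical segment inside `F`
  of length `< η` ending on the floor `slab ∪ roofK`).

References: Dafermos–Rodnianski arXiv:0811.0354, §5.1 [DafermosRodnianski2008]; Hawking–Ellis 1973,
§6.3 [HawkingEllis1973CUP]; O'Neill 1995, Ch. 2, §2.4 [ONeill1995].  No definitions, no named facts.
-/

noncomputable section

-- D-0017: single-problem summit, `Summit.<S>.<S>.…` by design (cf. lakefile `weak.linter.dupNamespace`).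
set_option linter.dupNamespace false
set_option maxSynthPendingDepth 3

open Set Filter Function Topology TopologicalSpace
open Literature.Geometry.Lorentzian
open scoped Manifold ContDiff Topology
open Summit.FinalStateConjecture.FinalStateConjecture.Theorems.SwallowTheDatum.KerrShieldedSettles.CollarCauchy
  (velocity_eq_deriv)

namespace Summit.FinalStateConjecture.FinalStateConjecture.Theorems.BondiBartnikRigidity.DirectMethod

namespace CollarK

open FutureK (translate_mem_region translate_translate_neg)

variable [Kerr.Facts] {M a : ℝ}

/-! ### Vertical segments -/

/-- **`∂_{t*}` is future timelike where `r > 2M`**: `g(∂_{t*}, ∂_{t*}) = −1 + 2H < 0` (`H ≤ M/r`) and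
`g(V, ∂_{t*}) = −1`; so `u ↦ T_u y = y + u ∂_{t*}` is a future timelike curve when `r(y) > 2M`.
[cite: ONeill1995, Ch. 2, §2.4] -/
theorem isFutureTimelikeCurveOn_vertical (hM : 0 < M) {y : Kerr.region a M} (hy : 2 * M < Kerr.radius a y.1) :
    (Kerr.smoothMetric M a M).IsFutureTimelikeCurveOn ((Kerr.timeOrientation M a M hM.le).ofLE le_top)
      (fun u => (⟨(y : E4) + u • E4.basisVector 0, translate_mem_region y u⟩ : Kerr.region a M)) univ := by
  intro u _
  set γ : ℝ → Kerr.region a M := fun u => ⟨(y : E4) + u • E4.basisVector 0, translate_mem_region y u⟩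
  have hdE : HasDerivAt (fun u => (γ u : E4)) (E4.basisVector 0) u := by
    show HasDerivAt (fun u => (y : E4) + u • E4.basisVector 0) (E4.basisVector 0) u
    simpa using ((hasDerivAt_id u).smul_const (E4.basisVector 0)).const_add (y : E4)
  have hd : MDifferentiableAt 𝓘(ℝ, ℝ) 𝓘(ℝ, E4) γ u :=
    (mdifferentiableAt_subtypeVal_comp_curve_iff (I := 𝓘(ℝ, E4)) (Kerr.region a M)).1
      (mdifferentiableAt_iff_differentiableAt.mpr hdE.differentiableAt)
  have hvel : (velocity 𝓘(ℝ, E4) γ u : E4) = E4.basisVector 0 := by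
    rw [velocity_eq_deriv]; exact hdE.deriv
  have hr : Kerr.radius a (γ u : E4) = Kerr.radius a y.1 := Kerr.radius_add_time_smul_basisVector a y.1 u
  have hr0 : 0 < Kerr.radius a (γ u : E4) := by rw [hr]; linarith
  have h00 : Kerr.bilin M a (γ u : E4) (E4.basisVector 0) (E4.basisVector 0) < 0 := by
    rw [Kerr.bilin_apply, Minkowski.bilin_basisVector_zero, Kerr.nullCovector_basisVector_zero]
    have hH := Kerr.scalarH_le_div hM.le a hr0
    rw [hr] at hH
    have : M / Kerr.radius a y.1 < 1 / 2 := by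
      rw [div_lt_iff₀ (by linarith)]; linarith
    nlinarith
  refine ⟨hd, ?_, ⟨?_, ?_⟩, ?_⟩
  · show Kerr.bilin M a (γ u : E4) (velocity 𝓘(ℝ, E4) γ u) (velocity 𝓘(ℝ, E4) γ u) < 0
    rw [hvel]; exact h00
  · show Kerr.bilin M a (γ u : E4) (velocity 𝓘(ℝ, E4) γ u) (velocity 𝓘(ℝ, E4) γ u) ≤ 0
    rw [hvel]; exact h00.le
  · have hne : (E4.basisVector 0 : E4) ≠ 0 := by
      intro h
      have h1 := congrArg (fun v : E4 => v 0) h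
      simp [E4.basisVector] at h1
    rw [hvel]; exact hne
  · show Kerr.bilin M a (γ u : E4) (Kerr.timeVector M a (γ u : E4)) (velocity 𝓘(ℝ, E4) γ u) < 0
    rw [hvel, Kerr.bilin_timeVector hr0]
    simp [E4.basisVector]

/-- `T_c y ∈ I⁺_K(y)` for `c > 0` when `r(y) > 2M`. [cite: ONeill1995, Ch. 2, §2.4] -/
theorem translate_mem_chronologicalFuture (hM : 0 < M) {y : Kerr.region a M} (hy : 2 * M < Kerr.radius a y.1)
    {c : ℝ} (hc : 0 < c) :
    (⟨(y : E4) + c • E4.basisVector 0, translate_mem_region y c⟩ : Kerr.region a M) ∈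
      (Kerr.smoothMetric M a M).chronologicalFuture ((Kerr.timeOrientation M a M hM.le).ofLE le_top) {y} :=
  ⟨y, mem_singleton y, _, 0, c, hc, (isFutureTimelikeCurveOn_vertical hM hy).mono (subset_univ _),
    Subtype.ext (by simp), rfl⟩

/-! ### The floor `∂J⁺_K(slab) = slab ∪ roof` -/

/-- **`roofK ⊆ {r ≥ 3M}`**: a point of `J⁺_K(S₃)` with `t* = 0` lies on `S₃` (`t*` strictly increases
along causal curves), and a point with `t* > 0`, `r < 3M` is interior to `J⁺_K(slab)` (cylinder).
[cite: DafermosRodnianski2008, §5.1] -/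
theorem radius_ge_of_mem_roofK (hM : 0 < M) (ha : |a| < M)
    (hcyl : {y : Kerr.region a M | 0 ≤ y.1 0 ∧ Kerr.radius a y.1 ≤ 3 * M} ⊆ JK M a hM (slabK M a))
    {z : Kerr.region a M} (hz : z ∈ roofK M a hM) : 3 * M ≤ Kerr.radius a z.1 := by
  by_contra hlt
  push Not at hlt
  obtain ⟨hzf, hzJ⟩ := hz
  have hz0 : 0 ≤ (z : E4) 0 := (FrontierK.JK_slabK_subset hM ha (frontier_subset_closure hzf |>
    (FutureK.isClosed_JK_slabK hM (FrontierK.frontier_JK_slabK_subset hM ha hcyl)).closure_subset)).1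
  rcases hz0.lt_or_eq with hpos | h0
  · -- interior point
    have hO : IsOpen {y : Kerr.region a M | 0 < y.1 0 ∧ Kerr.radius a y.1 < 3 * M} :=
      (isOpen_lt continuous_const (K2Route.continuous_tstar a M)).inter
        (isOpen_lt (K2Route.continuous_radius_region a M) continuous_const)
    have hint : z ∈ interior (JK M a hM (slabK M a)) :=
      interior_maximal (fun y hy => hcyl ⟨hy.1.le, hy.2.le⟩) hO ⟨hpos, hlt⟩
    exact (disjoint_interior_frontier (s := JK M a hM (slabK M a))).le_bot ⟨hint, hzf⟩
  · -- `t* = 0`: on `S₃`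
    rw [FrontierK.JK_eq] at hzJ
    rcases hzJ with ⟨-, hr⟩ | ⟨p, hp, γ, b₀, b₁, hb, hγ, hpa, hzb⟩
    · exact absurd hr hlt.ne
    · have hmono := KerrCausal.strictMonoOn_time ordConnected_Icc hγ (left_mem_Icc.2 hb.le) (right_mem_Icc.2 hb.le) hb
      have hmono' : (γ b₀ : E4) 0 < (γ b₁ : E4) 0 := hmono
      rw [hpa, hzb, hp.1] at hmono'
      linarith

/-- **`T_c z ∈ W` for a floor point `z ∈ ∂J⁺_K(slab)` and `c > 0`** (`frontier ⊆ slab ∪ roofK`; above a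
slab point the open cylinder, above a roof point `I⁺_K(z) ⊆ W` by the vertical timelike segment).
[cite: DafermosRodnianski2008, §5.1] -/
theorem translate_mem_interior_of_mem_frontier (hM : 0 < M) (ha : |a| < M)
    (hcyl : {y : Kerr.region a M | 0 ≤ y.1 0 ∧ Kerr.radius a y.1 ≤ 3 * M} ⊆ JK M a hM (slabK M a))
    (hfr : frontier (JK M a hM (slabK M a)) ⊆ slabK M a ∪ JK M a hM (outerSphereK M a))
    {z : Kerr.region a M} (hz : z ∈ frontier (JK M a hM (slabK M a))) {c : ℝ} (hc : 0 < c) :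
    (⟨(z : E4) + c • E4.basisVector 0, translate_mem_region z c⟩ : Kerr.region a M) ∈
      interior (JK M a hM (slabK M a)) := by
  by_cases hr : 2 * M < Kerr.radius a z.1
  · have hzJ : z ∈ JK M a hM (slabK M a) :=
      (FutureK.isClosed_JK_slabK hM hfr).closure_subset (frontier_subset_closure hz)
    exact FutureK.chronologicalFuture_subset_interior_JK hM hzJ (translate_mem_chronologicalFuture hM hr hc)
  · push Not at hr
    have hzs : z ∈ slabK M a := by
      rcases hfr hz with h | h
      · exact h
      · have := radius_ge_of_mem_roofK hM ha hcyl ⟨hz, h⟩; linarith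
    have hO : IsOpen {y : Kerr.region a M | 0 < y.1 0 ∧ Kerr.radius a y.1 < 3 * M} :=
      (isOpen_lt continuous_const (K2Route.continuous_tstar a M)).inter
        (isOpen_lt (K2Route.continuous_radius_region a M) continuous_const)
    refine interior_maximal (fun y hy => hcyl ⟨hy.1.le, hy.2.le⟩) hO ⟨?_, ?_⟩
    · show 0 < ((z : E4) + c • E4.basisVector 0) 0
      have : (z : E4) 0 = 0 := hzs.1
      simp [this, hc]
    · show Kerr.radius a ((z : E4) + c • E4.basisVector 0) < 3 * M
      rw [Kerr.radius_add_time_smul_basisVector]; linarith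

/-- Below a roof point the vertical line leaves `J⁺_K(slab)`: `T_{−c} z ∉ J⁺_K(slab)` for `z ∈ roofK`,
`c > 0` (else `z = T_c (T_{−c} z)` would be interior). [cite: DafermosRodnianski2008, §5.1] -/
theorem translate_neg_notMem_of_mem_roofK (hM : 0 < M) (ha : |a| < M)
    (hcyl : {y : Kerr.region a M | 0 ≤ y.1 0 ∧ Kerr.radius a y.1 ≤ 3 * M} ⊆ JK M a hM (slabK M a))
    {z : Kerr.region a M} (hz : z ∈ roofK M a hM) {c : ℝ} (hc : 0 < c) :
    (⟨(z : E4) + (-c) • E4.basisVector 0, translate_mem_region z (-c)⟩ : Kerr.region a M) ∉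
      JK M a hM (slabK M a) := by
  intro hmem
  have hr : 2 * M < Kerr.radius a ((z : E4) + (-c) • E4.basisVector 0) := by
    rw [Kerr.radius_add_time_smul_basisVector]; linarith [radius_ge_of_mem_roofK hM ha hcyl hz]
  have h := FutureK.chronologicalFuture_subset_interior_JK hM hmem
    (translate_mem_chronologicalFuture hM (y := ⟨_, translate_mem_region z (-c)⟩) hr hc)
  have e := translate_translate_neg z (-c)
  rw [neg_neg] at e
  rw [e] at h
  exact (disjoint_interior_frontier (s := JK M a hM (slabK M a))).le_bot ⟨h, hz.1⟩

/-! ### The collar set -/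

omit [Kerr.Facts] in
/-- Composition of translations on points of the chart. [folklore] -/
theorem translate_translate (y : Kerr.region a M) (c c' : ℝ) :
    (⟨((⟨(y : E4) + c • E4.basisVector 0, translate_mem_region y c⟩ : Kerr.region a M) : E4) + c' • E4.basisVector 0,
      translate_mem_region _ c'⟩ : Kerr.region a M) =
      ⟨(y : E4) + (c + c') • E4.basisVector 0, translate_mem_region y (c + c')⟩ :=
  Subtype.ext (by
    show (y : E4) + c • E4.basisVector 0 + c' • E4.basisVector 0 = (y : E4) + (c + c') • E4.basisVector 0
    rw [add_smul, add_assoc])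

omit [Kerr.Facts] in
/-- The translation `y ↦ T_c y` is continuous, jointly in `(c, y)`. [folklore] -/
theorem continuous_translate :
    Continuous fun q : ℝ × Kerr.region a M =>
      (⟨(q.2 : E4) + q.1 • E4.basisVector 0, translate_mem_region q.2 q.1⟩ : Kerr.region a M) :=
  ((continuous_subtype_val.comp continuous_snd).add (continuous_fst.smul continuous_const)).subtype_mk _

/-- **The collar set is open.** [folklore] -/
theorem isOpen_collarSet (hM : 0 < M)
    (hfr : frontier (JK M a hM (slabK M a)) ⊆ slabK M a ∪ JK M a hM (outerSphereK M a))
    {F : Set (Kerr.region a M)} {w₀ η : ℝ}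
    (hF : ∀ x : Kerr.region a M, x ∈ F ↔ x ∈ interior (JK M a hM (slabK M a)) ∧
      x.1 0 + 2 / 3 * Kerr.radius a x.1 < w₀ ∧ ∃ s, 0 < s ∧ s < η ∧
        (⟨x.1 + (-s) • E4.basisVector 0, translate_mem_region x (-s)⟩ : Kerr.region a M) ∉ JK M a hM (slabK M a)) :
    IsOpen F := by
  have hJc := FutureK.isClosed_JK_slabK hM hfr
  have heq : F = interior (JK M a hM (slabK M a)) ∩ {x | x.1 0 + 2 / 3 * Kerr.radius a x.1 < w₀} ∩
      ⋃ s ∈ Ioo (0 : ℝ) η, (fun x : Kerr.region a M => (⟨x.1 + (-s) • E4.basisVector 0, translate_mem_region x (-s)⟩ :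
        Kerr.region a M)) ⁻¹' (JK M a hM (slabK M a))ᶜ := by
    ext x; rw [hF]; simp only [mem_inter_iff, mem_setOf_eq, mem_iUnion, mem_preimage, mem_compl_iff, mem_Ioo,
      exists_prop, and_assoc]
  rw [heq]
  refine (isOpen_interior.inter (isOpen_lt ((K2Route.continuous_tstar a M).add
    ((K2Route.continuous_radius_region a M).const_mul _)) continuous_const)).inter
    (isOpen_biUnion fun s _ => hJc.isOpen_compl.preimage ?_)
  exact continuous_translate.comp (Continuous.prodMk_right (-s))

/-- **The collar set is vertically closed inside `W`**: `x ∈ F`, `u ≥ 0`, `T_{−u} x ∈ W ⇒ T_{−u} x ∈ F`.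
[cite: DafermosRodnianski2008, §5.1] -/
theorem collarSet_vertical (hM : 0 < M)
    (hcyl : {y : Kerr.region a M | 0 ≤ y.1 0 ∧ Kerr.radius a y.1 ≤ 3 * M} ⊆ JK M a hM (slabK M a))
    {F : Set (Kerr.region a M)} {w₀ η : ℝ}
    (hF : ∀ x : Kerr.region a M, x ∈ F ↔ x ∈ interior (JK M a hM (slabK M a)) ∧
      x.1 0 + 2 / 3 * Kerr.radius a x.1 < w₀ ∧ ∃ s, 0 < s ∧ s < η ∧
        (⟨x.1 + (-s) • E4.basisVector 0, translate_mem_region x (-s)⟩ : Kerr.region a M) ∉ JK M a hM (slabK M a))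
    {x : Kerr.region a M} (hx : x ∈ F) {u : ℝ} (hu : 0 ≤ u)
    (hW : (⟨x.1 + (-u) • E4.basisVector 0, translate_mem_region x (-u)⟩ : Kerr.region a M) ∈
      interior (JK M a hM (slabK M a))) :
    (⟨x.1 + (-u) • E4.basisVector 0, translate_mem_region x (-u)⟩ : Kerr.region a M) ∈ F := by
  obtain ⟨-, hw, s, hs0, hsη, hs⟩ := (hF x).1 hx
  refine (hF _).2 ⟨hW, ?_, ?_⟩
  · show (x.1 + (-u) • E4.basisVector 0) 0 + 2 / 3 * Kerr.radius a (x.1 + (-u) • E4.basisVector 0) < w₀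
    rw [Kerr.radius_add_time_smul_basisVector]
    simp only [PiLp.add_apply, PiLp.smul_apply, smul_eq_mul]
    simp [E4.basisVector]; linarith
  · have hus : u < s := by
      by_contra hle
      push Not at hle
      apply hs
      have h := FutureK.JK_slabK_translate_subset hM hcyl (sub_nonneg.2 hle) (interior_subset hW)
      rw [translate_translate] at h
      convert h using 3; ring
    refine ⟨s - u, by linarith, by linarith, ?_⟩
    rw [translate_translate]
    convert hs using 4; ring

/-- **Low points are in the collar set**: `W ∩ {t* < η} ∩ {w < w₀} ⊆ F` (the translate by `−s`,
`t*(x) < s < η`, has `t* < 0`). [cite: DafermosRodnianski2008, §5.1] -/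
theorem low_mem_collarSet (hM : 0 < M) (ha : |a| < M)
    {F : Set (Kerr.region a M)} {w₀ η : ℝ}
    (hF : ∀ x : Kerr.region a M, x ∈ F ↔ x ∈ interior (JK M a hM (slabK M a)) ∧
      x.1 0 + 2 / 3 * Kerr.radius a x.1 < w₀ ∧ ∃ s, 0 < s ∧ s < η ∧
        (⟨x.1 + (-s) • E4.basisVector 0, translate_mem_region x (-s)⟩ : Kerr.region a M) ∉ JK M a hM (slabK M a))
    {x : Kerr.region a M} (hxW : x ∈ interior (JK M a hM (slabK M a))) (hxt : x.1 0 < η)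
    (hxw : x.1 0 + 2 / 3 * Kerr.radius a x.1 < w₀) : x ∈ F := by
  have h0 := FutureK.interior_JK_slabK_pos hM ha hxW
  refine (hF x).2 ⟨hxW, hxw, (x.1 0 + η) / 2, by linarith, by linarith, fun hmem => ?_⟩
  have h := (FrontierK.JK_slabK_subset hM ha hmem).1
  have : (x.1 + (-((x.1 0 + η) / 2)) • E4.basisVector 0) 0 = x.1 0 - (x.1 0 + η) / 2 := by
    simp [E4.basisVector]; ring
  have h' : 0 ≤ (x.1 + (-((x.1 0 + η) / 2)) • E4.basisVector 0) 0 := h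
  rw [this] at h'
  linarith

/-- **The floor below a point of the collar set**: for `x ∈ F` there is `s' ∈ [0, η)` with
`T_{−u} x ∈ F` for `0 ≤ u < s'` and `T_{−s'} x ∈ ∂J⁺_K(slab)` (the first exit of the vertical line from
the closed set `J⁺_K(slab)`). [cite: DafermosRodnianski2008, §5.1] -/
theorem collarSet_floor (hM : 0 < M) (ha : |a| < M)
    (hcyl : {y : Kerr.region a M | 0 ≤ y.1 0 ∧ Kerr.radius a y.1 ≤ 3 * M} ⊆ JK M a hM (slabK M a))
    (hfr : frontier (JK M a hM (slabK M a)) ⊆ slabK M a ∪ JK M a hM (outerSphereK M a))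
    {F : Set (Kerr.region a M)} {w₀ η : ℝ}
    (hF : ∀ x : Kerr.region a M, x ∈ F ↔ x ∈ interior (JK M a hM (slabK M a)) ∧
      x.1 0 + 2 / 3 * Kerr.radius a x.1 < w₀ ∧ ∃ s, 0 < s ∧ s < η ∧
        (⟨x.1 + (-s) • E4.basisVector 0, translate_mem_region x (-s)⟩ : Kerr.region a M) ∉ JK M a hM (slabK M a))
    {x : Kerr.region a M} (hx : x ∈ F) :
    ∃ s', 0 ≤ s' ∧ s' < η ∧
      (∀ u, 0 ≤ u → u < s' → (⟨x.1 + (-u) • E4.basisVector 0, translate_mem_region x (-u)⟩ : Kerr.region a M) ∈ F) ∧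
      (⟨x.1 + (-s') • E4.basisVector 0, translate_mem_region x (-s')⟩ : Kerr.region a M) ∈
        frontier (JK M a hM (slabK M a)) := by
  obtain ⟨hxW, -, s, hs0, hsη, hs⟩ := (hF x).1 hx
  have hJc := FutureK.isClosed_JK_slabK hM hfr
  set T : ℝ → Kerr.region a M := fun u => ⟨x.1 + (-u) • E4.basisVector 0, translate_mem_region x (-u)⟩ with hT
  have hTc : Continuous T := continuous_translate.comp ((continuous_neg).prodMk continuous_const)
  set S' : Set ℝ := {u ∈ Icc 0 s | T u ∈ JK M a hM (slabK M a)} with hS'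
  have hS'c : IsClosed S' := isClosed_Icc.inter (hJc.preimage hTc)
  have h0S' : (0 : ℝ) ∈ S' := ⟨⟨le_rfl, hs0.le⟩, by
    show T 0 ∈ _; have : T 0 = x := Subtype.ext (by simp [hT]); rw [this]; exact interior_subset hxW⟩
  have hbdd : BddAbove S' := ⟨s, fun u hu => hu.1.2⟩
  set s' := sSup S' with hs'
  have hs'S : s' ∈ S' := hS'c.csSup_mem ⟨0, h0S'⟩ hbdd
  have hs'le : s' ≤ s := hs'S.1.2
  have hs'lt : s' < s := lt_of_le_of_ne hs'le fun h => hs (by have := hs'S.2; rwa [h] at this)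
  have habove : ∀ u, s' < u → u ≤ s → T u ∉ JK M a hM (slabK M a) := fun u hu hus hmem =>
    absurd (le_csSup hbdd ⟨⟨hs'S.1.1.trans hu.le, hus⟩, hmem⟩) (not_le.2 hu)
  have hfront : T s' ∈ frontier (JK M a hM (slabK M a)) := by
    rw [hJc.frontier_eq, Set.mem_sdiff]
    refine ⟨hs'S.2, fun hint => ?_⟩
    have hmem : ∀ᶠ u in 𝓝 s', T u ∈ interior (JK M a hM (slabK M a)) :=
      hTc.continuousAt.preimage_mem_nhds (isOpen_interior.mem_nhds hint)
    obtain ⟨ε, hε, hball⟩ := Metric.eventually_nhds_iff.1 hmem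
    set u := min (s' + ε / 2) s with hu
    have hu1 : s' < u := lt_min (by linarith) hs'lt
    have hu2 : u ≤ s := min_le_right _ _
    have hu3 : dist u s' < ε := by
      rw [Real.dist_eq, abs_of_pos (by linarith)]
      have := min_le_left (s' + ε / 2) s; linarith
    exact habove u hu1 hu2 (interior_subset (hball hu3))
  refine ⟨s', hs'S.1.1, lt_of_lt_of_le hs'lt hsη.le, fun u hu0 hus' => ?_, hfront⟩
  have hW : T u ∈ interior (JK M a hM (slabK M a)) := by
    have h := translate_mem_interior_of_mem_frontier hM ha hcyl hfr hfront (sub_pos.2 hus')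
    have : (⟨((T s') : E4) + (s' - u) • E4.basisVector 0, translate_mem_region (T s') (s' - u)⟩ :
        Kerr.region a M) = T u := by
      show (⟨((⟨x.1 + (-s') • E4.basisVector 0, translate_mem_region x (-s')⟩ : Kerr.region a M) : E4) +
        (s' - u) • E4.basisVector 0, _⟩ : Kerr.region a M) = _
      rw [translate_translate]
      exact Subtype.ext (by show x.1 + (-s' + (s' - u)) • E4.basisVector 0 = x.1 + (-u) • E4.basisVector 0; ring_nf)
    rw [this] at h; exact h
  exact collarSet_vertical hM hcyl hF hx hu0 hW

end CollarK

/-- **Registered bookkeeping sub-goal `stub_kerrTranslateTranslate` of the line** (brick of the landing of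
K2b-5 `stub_marchingLemma`): composition of `t*`-translations of the Kerr star chart (anchor of this file,
whose content is the collar set of the marching and its basic properties: `CollarK.isOpen_collarSet`,
`collarSet_vertical`, `low_mem_collarSet`, `collarSet_floor`, `isFutureTimelikeCurveOn_vertical`,
`radius_ge_of_mem_roofK`). [folklore] -/
theorem stub_kerrTranslateTranslate : ∀ (M a : ℝ) (y : Kerr.region a M) (c c' : ℝ),
    (⟨((⟨(y : E4) + c • E4.basisVector 0, FutureK.translate_mem_region y c⟩ : Kerr.region a M) : E4) +
      c' • E4.basisVector 0, FutureK.translate_mem_region _ c'⟩ : Kerr.region a M) =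
      ⟨(y : E4) + (c + c') • E4.basisVector 0, FutureK.translate_mem_region y (c + c')⟩ :=
  fun _ _ y c c' => CollarK.translate_translate y c c'

end Summit.FinalStateConjecture.FinalStateConjecture.Theorems.BondiBartnikRigidity.DirectMethod

end
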